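/-
Copyright (c) 2026 the pub-hodgecm-mathlib formalisation cell (harness21).  Prover seat hodgecm-mathlib-F0P3a-p02 (g17): road «S3-ram» (LEAD F0P3a-plan (g12);
architect A-p16 (g31); junction sub-architect F0P3a-p01 (g16)), organ A′ (ii) (a2) — ENGINE ED. 3 «ROOT-REGION (AXIS) ASSEMBLY» for the isoceles type-(1) literals
(BLUEPRINT-a2B (B7-iso) of F0P3a-p01 (g16)); 2026-09-02.
-/
import Literature.NumberTheory.Rogawski1990.DepthZeroKappaTransferTypeOneRamifiedTreeInduction   -- ★ G5 engine (p847302): one step, apex indicator, the induction, equilateral root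
import HarnessLib

/-!
# The ramified type-(1) `κ`-orbital integral: the tree induction OFF A ROOT REGION and the ROOT-REGION (AXIS) ASSEMBLY of the strata totals
# (Kottwitz 1986 §3; Rogawski 1990 §4.9; Serre, *Trees* I.2.3, II.1.1)

Topic `NumberTheory/Rogawski1990`; namespace `Literature.NumberTheory.Rogawski1990`.  THEOREMS ONLY (no definition, no instance, no notation, no named fact, no `sorry`);
kernel lane `--supports stmt-HodgeConjecture-24833`; imports ★ `DepthZeroKappaTransferTypeOneRamifiedTreeInduction` (the G5 engine of F0P3a-p01 (g16)) only — a GENERIC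
rooted-tree statement (any `SimpleGraph`, any vertex type), no lattice ∕ CM token.  Cell `pub/hodgecm-mathlib` (D-0151), crux H413; road «S3-ram» (Literature seeding,
count-neutral), P-1-ram organ A′ (ii) (a2), BLUEPRINT-a2B (B7-iso) «ROOT ASSEMBLY, ISOCELES CONFIGURATION».

WHY THIS FILE.  The ★ engine `strataVec_cone_eq_of_localLaw` ∕ `strataVec_total_eq_of_localLaw_of_root` assumes the nilpotent-regime LOCAL BRANCHING LAW (`hB hC hR hE hO hP`)
at EVERY fixed self-dual vertex other than the root `r`, and assembles the total for the EQUILATERAL root (root region `{L₀}`, ★ `UnitaryLatticeTreeSeparableStableRoot`).  For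
the ISOCELES literals (★ `UnitaryLatticeTreeIsolatedIndexStableRoot`: the top-level fixed self-dual lattices `L′ ⊕ 𝒪e` form an AXIS `R ≅` a fixed ball of the binary tree) the
law is FALSE on the axis (level `d₀`, rank `2`, but the fixed grandchildren are not the `O`-row), so the junction needs (i) the induction with the law RELATIVISED to the vertices
OFF a root region `R ∋ r`, and (ii) the total assembled over `R`.  Both are proved here for an ARBITRARY root region, label-agnostically; `R = {r}` gives the ★ statements back.

THE SETTING (verbatim the ★ engine's: tree `G`, root `r`, finite parent-closed `F`, alternating `SD`, labels `dep rk cl`, strata `str`, grandchildren binder `GC` with `hGC`,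
residue cardinality `q`, class flip `s`, any solution `(TE, TO, TP)` of the shell recursion) plus a ROOT REGION `R : Set V` with
* `hRup : ∀ v ∈ F, SD v → ∀ w ∈ GC v, w ∈ R → v ∈ R` — the fixed self-dual GC-parent of a region vertex is a region vertex (in the lattice model: levels do not increase down
  the fixed tree, and `R = {level = d₀}` is the top level), and for the assembly `r ∈ R ⊆ F`, `SD` on `R`, `2 ≤ dep` on `R` (every region vertex sits in the stratum `0`);
* the law hypotheses `hrk hcl hodd hB hC hR hE hO hP` with `v ∉ R` in place of the ★ `v ≠ r` (nothing is assumed AT region vertices).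

**Contents.**
* §1 region bookkeeping: `grandchild_mem_and_sd_and_dist` (a fixed grandchild of a self-dual vertex is fixed, self-dual, two levels down, in the cone), `exists_grandchild_of_mem_cone`
  (DESCENT: a fixed self-dual proper descendant of a self-dual `v` descends from a fixed grandchild of `v`), `mem_region_of_mem_cone_of_mem_region` (CLOSURE: under `hRup` every
  fixed self-dual ancestor of a region vertex is a region vertex), `not_mem_region_of_grandchild` (off-region vertices have off-region grandchildren).
* §2 **`strataVec_cone_eq_of_localLaw_offRegion`** — the ★ induction with the law relativised off `R`: for `v ∈ F`, `SD v`, `v ∉ R`, the strata vector of the cone of `v` is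
  `T(label v)` (★ proof, verbatim up to `v ≠ r ↦ v ∉ R`).
* §3 **`strataVec_total_eq_of_localLaw_of_rootRegion`** — THE ROOT-REGION ASSEMBLY (label-agnostic): the TOTAL strata vector of the fixed self-dual vertices is
  `Σ_{v ∈ R} (e₄ + Σ_{w ∈ GC v, w ∉ R} T(label w))` (Finset binders `sR`, `sOff` with membership characterisations, engine style) — `#R·e₄` plus the cone vectors of all
  off-region grandchildren of region vertices.  Proof: induction over the region from its leaves (`R ∩ cone v = {v} ⊔ ⨆_{w ∈ GC v ∩ R} (R ∩ cone w)` by DESCENT + CLOSURE +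
  ★ `disjoint_setOf_dist_of_ne`), one ★ step `strataVec_cone_eq_indicator_add_sum` per region vertex, §2 at the off-region grandchildren, and `cone r = V` at the end.
* §4 **`strataVec_total_eq_of_localLaw_of_rootRegion_of_labels`** — the same with the off-region grandchildren of each `v ∈ R` labelled `E_{k_v+1} ∕ P⁺_{k_v} ∕ P⁻_{k_v}` with
  multiplicities `NE v, NP v, NM v` (the ★ `hroot` shape, per region vertex): TOTAL `= Σ_{v ∈ R} (e₄ + NE v·T(E_{k_v+1}) + NP v·T(P⁺_{k_v}) + NM v·T(P⁻_{k_v}))`.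
The junction (F0P3a-p01 (g16)) instantiates `R` = the axis of ★ `UnitaryLatticeTreeIsolatedIndexStableRoot` with the per-vertex ROOT ∕ MIDDLE ∕ END multiplicities of ★
`DepthZeroKappaTransferTypeOneRamifiedAxisTwists` ∕ `…AxisEndTwists` (finite-field half) and ★ `UnitaryLatticeTreeIsolatedRootChildClassRamified` (lattice half).
HONEST LABEL: HC_CM is proved only modulo the 2 remaining named inputs (hLiu418 24832, h413 24833) until rung 0 closes; nothing printed is asserted here (rooted-tree bookkeeping).

## References
* [Kottwitz1986] R. E. Kottwitz, *Base change for unit elements of Hecke algebras*, Compositio Math. 60 (1986), §3 (counting fixed lattices shell by shell).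
* [Rogawski1990] J. D. Rogawski, *Automorphic Representations of Unitary Groups in Three Variables*, Ann. of Math. Stud. 123 (1990), §4.9 pp. 54–56 (the strata of the
  ramified orbital integrals; the two configurations of a type-(1) torus at a ramified place).
* [Serre1980Trees] J.-P. Serre, *Trees* (1980), I.2.3 (cones, projection onto a subtree), II.1.1 (the tree of lattices).
-/

set_option autoImplicit false

open Finset SimpleGraph
open Literature.Combinatorics.SimpleGraph.TreeLayers

namespace Literature.NumberTheory.Rogawski1990

variable {V : Type*} {G : SimpleGraph V}

/-! ## §1 Region bookkeeping: grandchildren, descent, closure -/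

/-- **A fixed grandchild of a self-dual vertex** `v` (member of the binder `GC v`) is fixed, self-dual (alternation), exactly two levels below `v`, and a descendant of `v`.
[cite: Serre1980Trees, I.2.3] [cite: Kottwitz1986, §3] -/
theorem grandchild_mem_and_sd_and_dist (hT : G.IsTree) (r : V) (F : Set V) (SD : V → Prop)
    (hSD₁ : ∀ v c, G.Adj v c → SD v → ¬ SD c) (hSD₂ : ∀ c w, G.Adj c w → ¬ SD c → SD w) (GC : V → Set V)
    (hGC : ∀ v w, w ∈ GC v ↔ ∃ c, (G.Adj v c ∧ G.dist r c = G.dist r v + 1 ∧ c ∈ F) ∧ (G.Adj c w ∧ G.dist r w = G.dist r c + 1 ∧ w ∈ F))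
    {v w : V} (hvS : SD v) (hw : w ∈ GC v) :
    w ∈ F ∧ SD w ∧ G.dist r w = G.dist r v + 2 ∧ G.dist r w = G.dist r v + G.dist v w := by
  obtain ⟨c, ⟨hvc, hdc, -⟩, hcw, hdw, hwF⟩ := (hGC v w).1 hw
  refine ⟨hwF, hSD₂ c w hcw (hSD₁ v c hvc hvS), by omega, ?_⟩
  have h1 : G.dist v w ≤ 2 := by
    calc G.dist v w ≤ G.dist v c + G.dist c w := hT.1.dist_triangle
      _ = 2 := by rw [dist_eq_one_iff_adj.2 hvc, dist_eq_one_iff_adj.2 hcw]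
  have h2 : G.dist r w ≤ G.dist r v + G.dist v w := hT.1.dist_triangle
  omega

/-- **DESCENT.**  In a rooted tree with parent-closed `F` and alternating `SD`: a fixed self-dual descendant `v′ ≠ v` of a self-dual vertex `v` descends from a fixed
GRANDCHILD of `v` (the vertices at distance `1` from `v` on the geodesic fail `SD`; the two intermediate vertices are fixed because `F` is ancestor-closed,
★ `mem_of_mem_setOf_dist_of_parentClosed`). [cite: Serre1980Trees, I.2.3] -/
theorem exists_grandchild_of_mem_cone (hT : G.IsTree) (r : V) (F : Set V)
    (hF : ∀ w ∈ F, w ≠ r → ∀ u, G.Adj w u → G.dist r u + 1 = G.dist r w → u ∈ F) (SD : V → Prop)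
    (hSD₁ : ∀ v c, G.Adj v c → SD v → ¬ SD c) (GC : V → Set V)
    (hGC : ∀ v w, w ∈ GC v ↔ ∃ c, (G.Adj v c ∧ G.dist r c = G.dist r v + 1 ∧ c ∈ F) ∧ (G.Adj c w ∧ G.dist r w = G.dist r c + 1 ∧ w ∈ F))
    {v v' : V} (hvS : SD v) (hv'F : v' ∈ F) (hv'S : SD v') (hv'v : G.dist r v' = G.dist r v + G.dist v v') (hne : v' ≠ v) :
    ∃ w ∈ GC v, G.dist r v' = G.dist r w + G.dist w v' := by
  have hmem : v' ∈ {w | G.dist r w = G.dist r v + G.dist v w} := hv'v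
  rw [setOf_dist_eq_add_dist_eq_insert_biUnion hT r v, Set.mem_insert_iff, Set.mem_iUnion₂] at hmem
  obtain ⟨c, ⟨hvc, hdc⟩, hc⟩ : ∃ c, (G.Adj v c ∧ G.dist r c = G.dist r v + 1) ∧ v' ∈ {w | G.dist r w = G.dist r c + G.dist c w} := by
    rcases hmem with heq | ⟨c, hc, hmc⟩
    · exact absurd heq hne
    · exact ⟨c, hc, hmc⟩
  have hcF : c ∈ F := mem_of_mem_setOf_dist_of_parentClosed hT r hF hv'F hc
  have hnec : v' ≠ c := by
    rintro rfl
    exact hSD₁ v _ hvc hvS hv'S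
  have hmem' : v' ∈ {w | G.dist r w = G.dist r c + G.dist c w} := hc
  rw [setOf_dist_eq_add_dist_eq_insert_biUnion hT r c, Set.mem_insert_iff, Set.mem_iUnion₂] at hmem'
  obtain ⟨w, ⟨hcw, hdw⟩, hw⟩ : ∃ w, (G.Adj c w ∧ G.dist r w = G.dist r c + 1) ∧ v' ∈ {u | G.dist r u = G.dist r w + G.dist w u} := by
    rcases hmem' with heq | ⟨w, hw, hmw⟩
    · exact absurd heq hnec
    · exact ⟨w, hw, hmw⟩
  have hwF : w ∈ F := mem_of_mem_setOf_dist_of_parentClosed hT r hF hv'F hw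
  exact ⟨w, (hGC v w).2 ⟨c, ⟨hvc, hdc, hcF⟩, hcw, hdw, hwF⟩, hw⟩

/-- **CLOSURE.**  If the fixed self-dual GC-parent of every region vertex is a region vertex (`hRup`), then every fixed self-dual ANCESTOR of a region vertex is a region
vertex (induction on the distance, by DESCENT). [cite: Serre1980Trees, I.2.3] -/
theorem mem_region_of_mem_cone_of_mem_region (hT : G.IsTree) (r : V) (F : Set V)
    (hF : ∀ w ∈ F, w ≠ r → ∀ u, G.Adj w u → G.dist r u + 1 = G.dist r w → u ∈ F) (SD : V → Prop)
    (hSD₁ : ∀ v c, G.Adj v c → SD v → ¬ SD c) (hSD₂ : ∀ c w, G.Adj c w → ¬ SD c → SD w) (GC : V → Set V)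
    (hGC : ∀ v w, w ∈ GC v ↔ ∃ c, (G.Adj v c ∧ G.dist r c = G.dist r v + 1 ∧ c ∈ F) ∧ (G.Adj c w ∧ G.dist r w = G.dist r c + 1 ∧ w ∈ F))
    (R : Set V) (hRF : R ⊆ F) (hRS : ∀ v ∈ R, SD v) (hRup : ∀ v ∈ F, SD v → ∀ w ∈ GC v, w ∈ R → v ∈ R)
    {w v' : V} (hwF : w ∈ F) (hwS : SD w) (hv'R : v' ∈ R) (hv'w : G.dist r v' = G.dist r w + G.dist w v') : w ∈ R := by
  suffices key : ∀ n (w : V), G.dist w v' = n → w ∈ F → SD w → G.dist r v' = G.dist r w + G.dist w v' → w ∈ R from key _ w rfl hwF hwS hv'w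
  intro n
  induction n using Nat.strong_induction_on with
  | _ n ih =>
  intro w hn hwF hwS hv'w
  by_cases hne : v' = w
  · exact hne ▸ hv'R
  · obtain ⟨w₁, hw₁, hv'w₁⟩ := exists_grandchild_of_mem_cone hT r F hF SD hSD₁ GC hGC hwS (hRF hv'R) (hRS v' hv'R) hv'w hne
    obtain ⟨hw₁F, hw₁S, hd₁, -⟩ := grandchild_mem_and_sd_and_dist hT r F SD hSD₁ hSD₂ GC hGC hwS hw₁
    have hlt : G.dist w₁ v' < n := by omega
    exact hRup w hwF hwS w₁ hw₁ (ih _ hlt w₁ rfl hw₁F hw₁S hv'w₁)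

/-- **Off-region vertices have off-region fixed grandchildren** (contrapositive of `hRup`: the root region is an up-set of the fixed self-dual tree). [cite: Serre1980Trees, I.2.3] -/
theorem not_mem_region_of_grandchild (F : Set V) (SD : V → Prop) (GC : V → Set V) (R : Set V)
    (hRup : ∀ v ∈ F, SD v → ∀ w ∈ GC v, w ∈ R → v ∈ R) {v w : V} (hv : v ∈ F) (hvS : SD v) (hvR : v ∉ R) (hw : w ∈ GC v) : w ∉ R :=
  fun hwR => hvR (hRup v hv hvS w hw hwR)

/-! ## §2 The induction OFF a root region -/

/-- **THE TREE INDUCTION OFF A ROOT REGION.**  The ★ engine `strataVec_cone_eq_of_localLaw` with the local branching law (`hrk hcl hodd hB hC hR hE hO hP`) assumed only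
at the fixed self-dual vertices OFF a root region `R` (`v ∉ R` in place of `v ≠ r`), `R` closed under fixed self-dual GC-parents (`hRup`): the strata vector of the cone of
every fixed self-dual vertex `v ∉ R` is `T(label v)` for any solution `(TE, TO, TP)` of the shell recursion.  `R = {r}` is the ★ statement.
[cite: Kottwitz1986, §3] [cite: Rogawski1990, §4.9 pp. 54–56] [cite: Serre1980Trees, I.2.3] -/
theorem strataVec_cone_eq_of_localLaw_offRegion (hT : G.IsTree) (r : V) (F : Set V) (hFfin : F.Finite)
    (hF : ∀ w ∈ F, w ≠ r → ∀ u, G.Adj w u → G.dist r u + 1 = G.dist r w → u ∈ F) (SD : V → Prop) (str : Fin 5 → V → Prop)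
    [DecidablePred (· ∈ F)] [DecidablePred SD] [∀ j, DecidablePred (str j)]
    (hSD₁ : ∀ v c, G.Adj v c → SD v → ¬ SD c) (hSD₂ : ∀ c w, G.Adj c w → ¬ SD c → SD w)
    (dep rk : V → ℕ) (cl : V → ℤ)
    (hstr : ∀ w ∈ F, SD w → (str 0 w ↔ dep w = 0) ∧ (str 1 w ↔ dep w = 1 ∧ rk w = 2) ∧ (str 2 w ↔ dep w = 1 ∧ rk w = 1 ∧ cl w = 1) ∧
      (str 3 w ↔ dep w = 1 ∧ rk w = 1 ∧ cl w = -1) ∧ (str 4 w ↔ 2 ≤ dep w))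
    (GC : V → Set V)
    (hGC : ∀ v w, w ∈ GC v ↔ ∃ c, (G.Adj v c ∧ G.dist r c = G.dist r v + 1 ∧ c ∈ F) ∧ (G.Adj c w ∧ G.dist r w = G.dist r c + 1 ∧ w ∈ F))
    (q : ℕ) (s : ℤ) (R : Set V) (hRup : ∀ v ∈ F, SD v → ∀ w ∈ GC v, w ∈ R → v ∈ R)
    (hrk : ∀ v ∈ F, SD v → v ∉ R → 1 ≤ dep v → rk v = 1 ∨ rk v = 2)
    (hcl : ∀ v ∈ F, SD v → v ∉ R → rk v = 1 → cl v = 1 ∨ cl v = -1)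
    (hodd : ∀ v ∈ F, SD v → v ∉ R → 2 ≤ dep v → rk v = 1 → Odd (dep v))
    (hB : ∀ v ∈ F, SD v → v ∉ R → dep v = 0 → GC v = ∅)
    (hC : ∀ v ∈ F, SD v → v ∉ R → dep v = 1 → rk v = 1 → GC v = ∅)
    (hR : ∀ v ∈ F, SD v → v ∉ R → dep v = 1 → rk v = 2 → (∀ w ∈ GC v, dep w = 0) ∧ (GC v).ncard = q)
    (hE : ∀ v ∈ F, SD v → v ∉ R → ∀ m, dep v = 2 * m + 2 → rk v = 2 → (∀ w ∈ GC v, dep w = 2 * m + 1 ∧ rk w = 2) ∧ (GC v).ncard = q ^ 2)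
    (hO : ∀ v ∈ F, SD v → v ∉ R → ∀ m, dep v = 2 * m + 3 → rk v = 2 →
      (∀ w ∈ GC v, (dep w = 2 * m + 2 ∧ rk w = 2) ∨ (dep w = 2 * m + 1 ∧ rk w = 1 ∧ (cl w = 1 ∨ cl w = -1))) ∧
        {w | w ∈ GC v ∧ dep w = 2 * m + 2}.ncard = q ∧ {w | w ∈ GC v ∧ dep w = 2 * m + 1 ∧ cl w = 1}.ncard = q.choose 2 ∧
          {w | w ∈ GC v ∧ dep w = 2 * m + 1 ∧ cl w = -1}.ncard = q.choose 2)
    (hP : ∀ v ∈ F, SD v → v ∉ R → ∀ m (c : ℤ), dep v = 2 * m + 3 → rk v = 1 → cl v = c →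
      (∀ w ∈ GC v, dep w = 2 * m + 1 ∧ rk w = 1 ∧ cl w = s * c) ∧ (GC v).ncard = q ^ 2)
    (TE TO : ℕ → Fin 5 → ℕ) (TP : ℤ → ℕ → Fin 5 → ℕ)
    (hTE : ∀ m, TE (m + 1) = ![0, 0, 0, 0, 1] + q ^ 2 • TO m)
    (hTO0 : TO 0 = ![0, 1, 0, 0, 0] + q • ![1, 0, 0, 0, 0])
    (hTOs : ∀ m, TO (m + 1) = ![0, 0, 0, 0, 1] + q • TE (m + 1) + q.choose 2 • (TP 1 m + TP (-1) m))
    (hTP0 : TP 1 0 = ![0, 0, 1, 0, 0]) (hTP0' : TP (-1) 0 = ![0, 0, 0, 1, 0])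
    (hTPs : ∀ m (c : ℤ), c = 1 ∨ c = -1 → TP c (m + 1) = ![0, 0, 0, 0, 1] + q ^ 2 • TP (s * c) m)
    {v : V} (hv : v ∈ F) (hvS : SD v) (hvR : v ∉ R) :
    (fun j => ({w | G.dist r w = G.dist r v + G.dist v w} ∩ F ∩ {w | SD w ∧ str j w}).ncard) =
      if dep v = 0 then ![1, 0, 0, 0, 0]
      else if rk v = 2 then (if Even (dep v) then TE (dep v / 2) else TO (dep v / 2)) else TP (cl v) (dep v / 2) := by
  -- strong induction on the depth label (★ proof of `strataVec_cone_eq_of_localLaw`, with `v ≠ r ↦ v ∉ R`)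
  suffices key : ∀ n (v : V), dep v = n → v ∈ F → SD v → v ∉ R →
      (fun j => ({w | G.dist r w = G.dist r v + G.dist v w} ∩ F ∩ {w | SD w ∧ str j w}).ncard) =
        if dep v = 0 then ![1, 0, 0, 0, 0]
        else if rk v = 2 then (if Even (dep v) then TE (dep v / 2) else TO (dep v / 2)) else TP (cl v) (dep v / 2) from
    key _ v rfl hv hvS hvR
  intro n
  induction n using Nat.strong_induction_on with
  | _ n ih =>
  intro v hdv hv hvS hvR
  -- the fixed grandchildren: a finite subset of `F`, self-dual, off the region
  have hGCF : GC v ⊆ F := fun w hw => (grandchild_mem_and_sd_and_dist hT r F SD hSD₁ hSD₂ GC hGC hvS hw).1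
  have hGCmem : ∀ w ∈ GC v, w ∈ F ∧ SD w ∧ w ∉ R := fun w hw =>
    ⟨(grandchild_mem_and_sd_and_dist hT r F SD hSD₁ hSD₂ GC hGC hvS hw).1, (grandchild_mem_and_sd_and_dist hT r F SD hSD₁ hSD₂ GC hGC hvS hw).2.1,
      not_mem_region_of_grandchild F SD GC R hRup hv hvS hvR hw⟩
  have hfin : (GC v).Finite := hFfin.subset hGCF
  have hsF : ∀ w, w ∈ hfin.toFinset ↔ w ∈ GC v := fun w => Set.Finite.mem_toFinset _
  have step := strataVec_cone_eq_indicator_add_sum hT r v F hFfin hF SD str (fun c hadj _ => hSD₁ v c hadj hvS) (GC v) (hGC v) hfin.toFinset hsF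
  rw [step]
  have hind := strataIndicator_eq_of_label (F := F) (SD := SD) (str := str) (dep := dep) (rk := rk) (cl := cl) hv hvS (hstr v hv hvS)
  obtain ⟨hI0, hI1, hI2, hI3, hI4⟩ := hind
  -- the induction hypothesis at a grandchild, as a function of its label
  have ihw : ∀ w ∈ GC v, dep w < dep v →
      (fun j => ({u | G.dist r u = G.dist r w + G.dist w u} ∩ F ∩ {u | SD u ∧ str j u}).ncard) =
        if dep w = 0 then ![1, 0, 0, 0, 0]
        else if rk w = 2 then (if Even (dep w) then TE (dep w / 2) else TO (dep w / 2)) else TP (cl w) (dep w / 2) := by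
    intro w hw hlt
    obtain ⟨hwF, hwS, hwR⟩ := hGCmem w hw
    exact ih (dep w) (hdv ▸ hlt) w rfl hwF hwS hwR
  -- finset cardinalities of label classes inside `GC v`
  have hcardGC : hfin.toFinset.card = (GC v).ncard := (Set.ncard_eq_toFinset_card _ hfin).symm
  rcases Nat.eq_zero_or_pos (dep v) with hd0 | hdpos
  · -- label B: a leaf
    have hempty : hfin.toFinset = ∅ := by
      rw [Finset.eq_empty_iff_forall_notMem]
      intro w hw
      have := (hsF w).1 hw
      rw [hB v hv hvS hvR hd0] at this
      exact this
    rw [hI0 hd0, hempty, Finset.sum_empty, add_zero, if_pos hd0]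
  rcases hrk v hv hvS hvR hdpos with hr1 | hr2
  · -- rank one: `C^c` (depth 1) or `P^c_{m+1}` (depth `2m+3`)
    have hcv := hcl v hv hvS hvR hr1
    rcases Nat.lt_or_ge (dep v) 2 with hd1 | hd2
    · -- C^c: a leaf
      have hd : dep v = 1 := by omega
      have hempty : hfin.toFinset = ∅ := by
        rw [Finset.eq_empty_iff_forall_notMem]
        intro w hw
        have := (hsF w).1 hw
        rw [hC v hv hvS hvR hd hr1] at this
        exact this
      rw [hempty, Finset.sum_empty, add_zero, if_neg (by omega), if_neg (by omega), hd]
      rcases hcv with hc | hc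
      · rw [hI2 hd hr1 hc, hc, hTP0]
      · rw [hI3 hd hr1 hc, hc, hTP0']
    · -- P^c_{m+1}
      obtain ⟨m, hm⟩ : ∃ m, dep v = 2 * m + 3 := by
        obtain ⟨k, hk⟩ := hodd v hv hvS hvR hd2 hr1
        exact ⟨k - 1, by omega⟩
      obtain ⟨hlab, hcard⟩ := hP v hv hvS hvR m (cl v) hm hr1 rfl
      have hsum : ∑ w ∈ hfin.toFinset, (fun j => ({u | G.dist r u = G.dist r w + G.dist w u} ∩ F ∩ {u | SD u ∧ str j u}).ncard) =
          ∑ w ∈ hfin.toFinset, TP (s * cl v) m := by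
        refine Finset.sum_congr rfl (fun w hw => ?_)
        have hw := (hsF w).1 hw
        obtain ⟨hdw, hrw, hcw⟩ := hlab w hw
        rw [ihw w hw (by omega), if_neg (by omega), if_neg (by omega), hcw, hdw]
        congr 1
        omega
      rw [hI4 hd2, hsum, Finset.sum_const, hcardGC, hcard, if_neg (by omega), if_neg (by omega), hm,
        show (2 * m + 3) / 2 = m + 1 by omega, hTPs m (cl v) hcv]
  · -- rank two: `R` (depth 1), `E_{m+1}` (depth `2m+2`), `O_{m+1}` (depth `2m+3`)
    rcases Nat.lt_or_ge (dep v) 2 with hd1 | hd2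
    · -- R = O_0
      have hd : dep v = 1 := by omega
      obtain ⟨hlab, hcard⟩ := hR v hv hvS hvR hd hr2
      have hsum : ∑ w ∈ hfin.toFinset, (fun j => ({u | G.dist r u = G.dist r w + G.dist w u} ∩ F ∩ {u | SD u ∧ str j u}).ncard) =
          ∑ w ∈ hfin.toFinset, (![1, 0, 0, 0, 0] : Fin 5 → ℕ) := by
        refine Finset.sum_congr rfl (fun w hw => ?_)
        have hw := (hsF w).1 hw
        rw [ihw w hw (by rw [hlab w hw]; omega), if_pos (hlab w hw)]
      rw [hI1 hd hr2, hsum, Finset.sum_const, hcardGC, hcard, if_neg (by omega), if_pos hr2, if_neg (by rw [hd]; decide), hd,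
        show 1 / 2 = 0 from rfl, hTO0]
    · rcases Nat.even_or_odd (dep v) with heven | hodd'
      · -- E_{m+1}
        obtain ⟨m, hm⟩ : ∃ m, dep v = 2 * m + 2 := by
          obtain ⟨k, hk⟩ := heven
          exact ⟨k - 1, by omega⟩
        obtain ⟨hlab, hcard⟩ := hE v hv hvS hvR m hm hr2
        have hsum : ∑ w ∈ hfin.toFinset, (fun j => ({u | G.dist r u = G.dist r w + G.dist w u} ∩ F ∩ {u | SD u ∧ str j u}).ncard) =
            ∑ w ∈ hfin.toFinset, TO m := by
          refine Finset.sum_congr rfl (fun w hw => ?_)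
          have hw := (hsF w).1 hw
          obtain ⟨hdw, hrw⟩ := hlab w hw
          rw [ihw w hw (by omega), if_neg (by omega), if_pos hrw, if_neg (by rw [hdw, Nat.even_add_one, Nat.even_mul]; simp), hdw,
            show (2 * m + 1) / 2 = m by omega]
        rw [hI4 hd2, hsum, Finset.sum_const, hcardGC, hcard, if_neg (by omega), if_pos hr2, if_pos heven, hm,
          show (2 * m + 2) / 2 = m + 1 by omega, hTE]
      · -- O_{m+1}
        obtain ⟨m, hm⟩ : ∃ m, dep v = 2 * m + 3 := by
          obtain ⟨k, hk⟩ := hodd'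
          exact ⟨k - 1, by omega⟩
        obtain ⟨hlab, hcE, hcP, hcM⟩ := hO v hv hvS hvR m hm hr2
        -- split the grandchildren by label
        have hsplit := (Finset.sum_filter_add_sum_filter_not hfin.toFinset (fun w => dep w = 2 * m + 2)
          (fun w => (fun j => ({u | G.dist r u = G.dist r w + G.dist w u} ∩ F ∩ {u | SD u ∧ str j u}).ncard))).symm
        have hsplit' := (Finset.sum_filter_add_sum_filter_not (hfin.toFinset.filter (fun w => ¬ dep w = 2 * m + 2)) (fun w => cl w = 1)
          (fun w => (fun j => ({u | G.dist r u = G.dist r w + G.dist w u} ∩ F ∩ {u | SD u ∧ str j u}).ncard))).symm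
        -- values on the three classes
        have hvE : ∀ w ∈ hfin.toFinset.filter (fun w => dep w = 2 * m + 2),
            (fun j => ({u | G.dist r u = G.dist r w + G.dist w u} ∩ F ∩ {u | SD u ∧ str j u}).ncard) = TE (m + 1) := by
          intro w hw
          rw [Finset.mem_filter] at hw
          have hw' := (hsF w).1 hw.1
          have hrw : rk w = 2 := by
            rcases hlab w hw' with ⟨-, h⟩ | ⟨h, -⟩
            · exact h
            · omega
          rw [ihw w hw' (by omega), if_neg (by omega), if_pos hrw, if_pos (by rw [hw.2]; exact ⟨m + 1, by ring⟩), hw.2,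
            show (2 * m + 2) / 2 = m + 1 by omega]
        have hvP : ∀ w ∈ (hfin.toFinset.filter (fun w => ¬ dep w = 2 * m + 2)).filter (fun w => cl w = 1),
            (fun j => ({u | G.dist r u = G.dist r w + G.dist w u} ∩ F ∩ {u | SD u ∧ str j u}).ncard) = TP 1 m := by
          intro w hw
          rw [Finset.mem_filter, Finset.mem_filter] at hw
          have hw' := (hsF w).1 hw.1.1
          obtain ⟨hdw, hrw, -⟩ : dep w = 2 * m + 1 ∧ rk w = 1 ∧ (cl w = 1 ∨ cl w = -1) := by
            rcases hlab w hw' with ⟨h, -⟩ | h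
            · exact absurd h hw.1.2
            · exact h
          rw [ihw w hw' (by omega), if_neg (by omega), if_neg (by omega), hw.2, hdw, show (2 * m + 1) / 2 = m by omega]
        have hvM : ∀ w ∈ (hfin.toFinset.filter (fun w => ¬ dep w = 2 * m + 2)).filter (fun w => ¬ cl w = 1),
            (fun j => ({u | G.dist r u = G.dist r w + G.dist w u} ∩ F ∩ {u | SD u ∧ str j u}).ncard) = TP (-1) m := by
          intro w hw
          rw [Finset.mem_filter, Finset.mem_filter] at hw
          have hw' := (hsF w).1 hw.1.1
          obtain ⟨hdw, hrw, hcw⟩ : dep w = 2 * m + 1 ∧ rk w = 1 ∧ (cl w = 1 ∨ cl w = -1) := by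
            rcases hlab w hw' with ⟨h, -⟩ | h
            · exact absurd h hw.1.2
            · exact h
          have hc : cl w = -1 := hcw.resolve_left hw.2
          rw [ihw w hw' (by omega), if_neg (by omega), if_neg (by omega), hc, hdw, show (2 * m + 1) / 2 = m by omega]
        -- the three cardinalities
        have hcE' : (hfin.toFinset.filter (fun w => dep w = 2 * m + 2)).card = q := by
          have hset : {w | w ∈ GC v ∧ dep w = 2 * m + 2} = ↑(hfin.toFinset.filter (fun w => dep w = 2 * m + 2)) := by
            ext w
            simp only [Set.mem_setOf_eq, Finset.coe_filter, Set.Finite.mem_toFinset]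
          rw [← hcE, hset, Set.ncard_coe_finset]
        have hcP' : ((hfin.toFinset.filter (fun w => ¬ dep w = 2 * m + 2)).filter (fun w => cl w = 1)).card = q.choose 2 := by
          have hset : {w | w ∈ GC v ∧ dep w = 2 * m + 1 ∧ cl w = 1} = ↑((hfin.toFinset.filter (fun w => ¬ dep w = 2 * m + 2)).filter (fun w => cl w = 1)) := by
            ext w
            simp only [Set.mem_setOf_eq, Finset.coe_filter, Finset.mem_filter, Set.Finite.mem_toFinset]
            constructor
            · rintro ⟨hw, hd, hc⟩
              exact ⟨⟨hw, by omega⟩, hc⟩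
            · rintro ⟨⟨hw, hne⟩, hc⟩
              rcases hlab w hw with ⟨h, -⟩ | ⟨h, -, -⟩
              · exact absurd h hne
              · exact ⟨hw, h, hc⟩
          rw [← hcP, hset, Set.ncard_coe_finset]
        have hcM' : ((hfin.toFinset.filter (fun w => ¬ dep w = 2 * m + 2)).filter (fun w => ¬ cl w = 1)).card = q.choose 2 := by
          have hset : {w | w ∈ GC v ∧ dep w = 2 * m + 1 ∧ cl w = -1} = ↑((hfin.toFinset.filter (fun w => ¬ dep w = 2 * m + 2)).filter (fun w => ¬ cl w = 1)) := by
            ext w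
            simp only [Set.mem_setOf_eq, Finset.coe_filter, Finset.mem_filter, Set.Finite.mem_toFinset]
            constructor
            · rintro ⟨hw, hd, hc⟩
              exact ⟨⟨hw, by omega⟩, by rw [hc]; norm_num⟩
            · rintro ⟨⟨hw, hne⟩, hc⟩
              rcases hlab w hw with ⟨h, -⟩ | ⟨h, -, hcw⟩
              · exact absurd h hne
              · exact ⟨hw, h, hcw.resolve_left hc⟩
          rw [← hcM, hset, Set.ncard_coe_finset]
        rw [hI4 hd2, hsplit, hsplit', Finset.sum_congr rfl hvE, Finset.sum_congr rfl hvP, Finset.sum_congr rfl hvM,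
          Finset.sum_const, Finset.sum_const, Finset.sum_const, hcE', hcP', hcM', if_neg (by omega), if_pos hr2,
          if_neg (by rw [hm, Nat.even_add_one, Nat.even_add_one, Nat.even_add_one, Nat.even_mul]; simp), hm,
          show (2 * m + 3) / 2 = m + 1 by omega, hTOs, smul_add]
        abel

/-! ## §3 The ROOT-REGION (axis) assembly: the total strata vector, label-agnostic -/

/-- **THE ROOT-REGION ASSEMBLY (BLUEPRINT-a2B (B7), isoceles-ready, label-agnostic).**  Under the local branching law OFF a root region `R` (as in
`strataVec_cone_eq_of_localLaw_offRegion`) with `r ∈ R ⊆ F`, every region vertex self-dual and of depth `≥ 2` (stratum `0`), and `R` closed under fixed self-dual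
GC-parents (`hRup`): the TOTAL strata vector of the fixed self-dual vertices is the sum over the region vertices `v` of `e₄` plus the cone vectors `T(label w)` of the
off-region fixed grandchildren `w` of `v` (Finset binders `sR ↔ R`, `sOff v ↔ GC v ∖ R`).  Equilateral: `R = {L₀}` (★ `strataVec_total_eq_of_localLaw_of_root`); isoceles:
`R` = the axis of ★ `UnitaryLatticeTreeIsolatedIndexStableRoot`. [cite: Kottwitz1986, §3] [cite: Rogawski1990, §4.9 pp. 54–56] [cite: Serre1980Trees, I.2.3] -/
theorem strataVec_total_eq_of_localLaw_of_rootRegion (hT : G.IsTree) (r : V) (F : Set V) (hFfin : F.Finite)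
    (hF : ∀ w ∈ F, w ≠ r → ∀ u, G.Adj w u → G.dist r u + 1 = G.dist r w → u ∈ F) (SD : V → Prop) (str : Fin 5 → V → Prop)
    [DecidablePred (· ∈ F)] [DecidablePred SD] [∀ j, DecidablePred (str j)]
    (hSD₁ : ∀ v c, G.Adj v c → SD v → ¬ SD c) (hSD₂ : ∀ c w, G.Adj c w → ¬ SD c → SD w)
    (dep rk : V → ℕ) (cl : V → ℤ)
    (hstr : ∀ w ∈ F, SD w → (str 0 w ↔ dep w = 0) ∧ (str 1 w ↔ dep w = 1 ∧ rk w = 2) ∧ (str 2 w ↔ dep w = 1 ∧ rk w = 1 ∧ cl w = 1) ∧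
      (str 3 w ↔ dep w = 1 ∧ rk w = 1 ∧ cl w = -1) ∧ (str 4 w ↔ 2 ≤ dep w))
    (GC : V → Set V)
    (hGC : ∀ v w, w ∈ GC v ↔ ∃ c, (G.Adj v c ∧ G.dist r c = G.dist r v + 1 ∧ c ∈ F) ∧ (G.Adj c w ∧ G.dist r w = G.dist r c + 1 ∧ w ∈ F))
    (q : ℕ) (s : ℤ) (R : Set V) (hrR : r ∈ R) (hRF : R ⊆ F) (hRS : ∀ v ∈ R, SD v) (hRdep : ∀ v ∈ R, 2 ≤ dep v)
    (hRup : ∀ v ∈ F, SD v → ∀ w ∈ GC v, w ∈ R → v ∈ R)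
    (hrk : ∀ v ∈ F, SD v → v ∉ R → 1 ≤ dep v → rk v = 1 ∨ rk v = 2)
    (hcl : ∀ v ∈ F, SD v → v ∉ R → rk v = 1 → cl v = 1 ∨ cl v = -1)
    (hodd : ∀ v ∈ F, SD v → v ∉ R → 2 ≤ dep v → rk v = 1 → Odd (dep v))
    (hB : ∀ v ∈ F, SD v → v ∉ R → dep v = 0 → GC v = ∅)
    (hC : ∀ v ∈ F, SD v → v ∉ R → dep v = 1 → rk v = 1 → GC v = ∅)
    (hR : ∀ v ∈ F, SD v → v ∉ R → dep v = 1 → rk v = 2 → (∀ w ∈ GC v, dep w = 0) ∧ (GC v).ncard = q)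
    (hE : ∀ v ∈ F, SD v → v ∉ R → ∀ m, dep v = 2 * m + 2 → rk v = 2 → (∀ w ∈ GC v, dep w = 2 * m + 1 ∧ rk w = 2) ∧ (GC v).ncard = q ^ 2)
    (hO : ∀ v ∈ F, SD v → v ∉ R → ∀ m, dep v = 2 * m + 3 → rk v = 2 →
      (∀ w ∈ GC v, (dep w = 2 * m + 2 ∧ rk w = 2) ∨ (dep w = 2 * m + 1 ∧ rk w = 1 ∧ (cl w = 1 ∨ cl w = -1))) ∧
        {w | w ∈ GC v ∧ dep w = 2 * m + 2}.ncard = q ∧ {w | w ∈ GC v ∧ dep w = 2 * m + 1 ∧ cl w = 1}.ncard = q.choose 2 ∧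
          {w | w ∈ GC v ∧ dep w = 2 * m + 1 ∧ cl w = -1}.ncard = q.choose 2)
    (hP : ∀ v ∈ F, SD v → v ∉ R → ∀ m (c : ℤ), dep v = 2 * m + 3 → rk v = 1 → cl v = c →
      (∀ w ∈ GC v, dep w = 2 * m + 1 ∧ rk w = 1 ∧ cl w = s * c) ∧ (GC v).ncard = q ^ 2)
    (TE TO : ℕ → Fin 5 → ℕ) (TP : ℤ → ℕ → Fin 5 → ℕ)
    (hTE : ∀ m, TE (m + 1) = ![0, 0, 0, 0, 1] + q ^ 2 • TO m)
    (hTO0 : TO 0 = ![0, 1, 0, 0, 0] + q • ![1, 0, 0, 0, 0])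
    (hTOs : ∀ m, TO (m + 1) = ![0, 0, 0, 0, 1] + q • TE (m + 1) + q.choose 2 • (TP 1 m + TP (-1) m))
    (hTP0 : TP 1 0 = ![0, 0, 1, 0, 0]) (hTP0' : TP (-1) 0 = ![0, 0, 0, 1, 0])
    (hTPs : ∀ m (c : ℤ), c = 1 ∨ c = -1 → TP c (m + 1) = ![0, 0, 0, 0, 1] + q ^ 2 • TP (s * c) m)
    (sR : Finset V) (hsR : ∀ v, v ∈ sR ↔ v ∈ R)
    (sOff : V → Finset V) (hsOff : ∀ v ∈ R, ∀ w, w ∈ sOff v ↔ w ∈ GC v ∧ w ∉ R) :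
    (fun j => (F ∩ {w | SD w ∧ str j w}).ncard) =
      ∑ v ∈ sR, ((![0, 0, 0, 0, 1] : Fin 5 → ℕ) + ∑ w ∈ sOff v,
        (if dep w = 0 then ![1, 0, 0, 0, 0]
          else if rk w = 2 then (if Even (dep w) then TE (dep w / 2) else TO (dep w / 2)) else TP (cl w) (dep w / 2))) := by
  classical
  -- the off-region cone theorem, as a function of the vertex
  have hoff : ∀ w ∈ F, SD w → w ∉ R →
      (fun j => ({u | G.dist r u = G.dist r w + G.dist w u} ∩ F ∩ {u | SD u ∧ str j u}).ncard) =
        if dep w = 0 then ![1, 0, 0, 0, 0]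
        else if rk w = 2 then (if Even (dep w) then TE (dep w / 2) else TO (dep w / 2)) else TP (cl w) (dep w / 2) :=
    fun w hw hwS hwR => strataVec_cone_eq_of_localLaw_offRegion hT r F hFfin hF SD str hSD₁ hSD₂ dep rk cl hstr GC hGC q s R hRup hrk hcl hodd hB hC hR hE hO hP
      TE TO TP hTE hTO0 hTOs hTP0 hTP0' hTPs hw hwS hwR
  -- CLAIM: for every region vertex `v`, the cone of `v` is assembled over the region vertices in the cone of `v` (induction on their number)
  suffices key : ∀ n (v : V), v ∈ R → (sR.filter (fun v' => G.dist r v' = G.dist r v + G.dist v v')).card = n →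
      (fun j => ({w | G.dist r w = G.dist r v + G.dist v w} ∩ F ∩ {w | SD w ∧ str j w}).ncard) =
        ∑ v' ∈ sR.filter (fun v' => G.dist r v' = G.dist r v + G.dist v v'), ((![0, 0, 0, 0, 1] : Fin 5 → ℕ) + ∑ w ∈ sOff v',
          (if dep w = 0 then ![1, 0, 0, 0, 0]
            else if rk w = 2 then (if Even (dep w) then TE (dep w / 2) else TO (dep w / 2)) else TP (cl w) (dep w / 2))) by
    have hcone : (fun j => (F ∩ {w | SD w ∧ str j w}).ncard) = fun j => ({w | G.dist r w = G.dist r r + G.dist r w} ∩ F ∩ {w | SD w ∧ str j w}).ncard := by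
      funext j
      rw [setOf_dist_eq_add_dist_root, Set.univ_inter]
    have hall : sR.filter (fun v' => G.dist r v' = G.dist r r + G.dist r v') = sR := by
      refine Finset.filter_true_of_mem (fun v' _ => ?_)
      rw [SimpleGraph.dist_self, zero_add]
    rw [hcone, key _ r hrR rfl, hall]
  intro n
  induction n using Nat.strong_induction_on with
  | _ n ih =>
  intro v hvR hn
  have hv : v ∈ F := hRF hvR
  have hvS : SD v := hRS v hvR
  -- the fixed grandchildren of `v`
  have hGCmem : ∀ w ∈ GC v, w ∈ F ∧ SD w ∧ G.dist r w = G.dist r v + 2 ∧ G.dist r w = G.dist r v + G.dist v w :=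
    fun w hw => grandchild_mem_and_sd_and_dist hT r F SD hSD₁ hSD₂ GC hGC hvS hw
  have hfin : (GC v).Finite := hFfin.subset (fun w hw => (hGCmem w hw).1)
  have hsF : ∀ w, w ∈ hfin.toFinset ↔ w ∈ GC v := fun w => Set.Finite.mem_toFinset _
  rw [strataVec_cone_eq_indicator_add_sum hT r v F hFfin hF SD str (fun c hadj _ => hSD₁ v c hadj hvS) (GC v) (hGC v) hfin.toFinset hsF,
    (strataIndicator_eq_of_label (F := F) (SD := SD) (str := str) (dep := dep) (rk := rk) (cl := cl) hv hvS (hstr v hv hvS)).2.2.2.2 (hRdep v hvR),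
    ← Finset.sum_filter_add_sum_filter_not hfin.toFinset (fun w => w ∈ R)]
  -- (a) the off-region grandchildren: §2, and the filter is `sOff v`
  have hoffsum : ∑ w ∈ hfin.toFinset.filter (fun w => ¬ w ∈ R), (fun j => ({u | G.dist r u = G.dist r w + G.dist w u} ∩ F ∩ {u | SD u ∧ str j u}).ncard) =
      ∑ w ∈ sOff v, (if dep w = 0 then ![1, 0, 0, 0, 0]
        else if rk w = 2 then (if Even (dep w) then TE (dep w / 2) else TO (dep w / 2)) else TP (cl w) (dep w / 2)) := by
    have hset : hfin.toFinset.filter (fun w => ¬ w ∈ R) = sOff v := by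
      ext w
      rw [Finset.mem_filter, hsF, hsOff v hvR]
    rw [hset]
    refine Finset.sum_congr rfl (fun w hw => ?_)
    obtain ⟨hwG, hwR⟩ := (hsOff v hvR w).1 hw
    exact hoff w (hGCmem w hwG).1 (hGCmem w hwG).2.1 hwR
  -- (b) the region grandchildren: the induction hypothesis
  have hregsum : ∑ w ∈ hfin.toFinset.filter (fun w => w ∈ R), (fun j => ({u | G.dist r u = G.dist r w + G.dist w u} ∩ F ∩ {u | SD u ∧ str j u}).ncard) =
      ∑ w ∈ hfin.toFinset.filter (fun w => w ∈ R), ∑ v' ∈ sR.filter (fun v' => G.dist r v' = G.dist r w + G.dist w v'),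
        ((![0, 0, 0, 0, 1] : Fin 5 → ℕ) + ∑ u ∈ sOff v',
          (if dep u = 0 then ![1, 0, 0, 0, 0]
            else if rk u = 2 then (if Even (dep u) then TE (dep u / 2) else TO (dep u / 2)) else TP (cl u) (dep u / 2))) := by
    refine Finset.sum_congr rfl (fun w hw => ?_)
    rw [Finset.mem_filter] at hw
    have hwG := (hsF w).1 hw.1
    obtain ⟨-, -, hd2, hcone⟩ := hGCmem w hwG
    refine ih _ ?_ w hw.2 rfl
    -- the region part of the cone of `w` is a PROPER subset of that of `v` (it misses `v`)
    rw [← hn]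
    refine Finset.card_lt_card ⟨fun v' hv' => ?_, fun hsub => ?_⟩
    · rw [Finset.mem_filter] at hv' ⊢
      exact ⟨hv'.1, setOf_dist_subset_of_mem hT r hcone hv'.2⟩
    · have hvmem : v ∈ sR.filter (fun v' => G.dist r v' = G.dist r v + G.dist v v') := by
        rw [Finset.mem_filter, hsR, SimpleGraph.dist_self, add_zero]
        exact ⟨hvR, rfl⟩
      have := (Finset.mem_filter.1 (hsub hvmem)).2
      have h0 : G.dist r v = G.dist r w + G.dist w v := this
      omega
  -- (c) the region part of the cone of `v` = `{v}` ⊔ the region parts of the cones of the region grandchildren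
  have hpart : sR.filter (fun v' => G.dist r v' = G.dist r v + G.dist v v') =
      insert v ((hfin.toFinset.filter (fun w => w ∈ R)).biUnion (fun w => sR.filter (fun v' => G.dist r v' = G.dist r w + G.dist w v'))) := by
    ext v'
    rw [Finset.mem_insert, Finset.mem_biUnion, Finset.mem_filter]
    constructor
    · rintro ⟨hv'R, hv'v⟩
      by_cases hne : v' = v
      · exact Or.inl hne
      · right
        rw [hsR] at hv'R
        obtain ⟨w, hw, hv'w⟩ := exists_grandchild_of_mem_cone hT r F hF SD hSD₁ GC hGC hvS (hRF hv'R) (hRS v' hv'R) hv'v hne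
        have hwR : w ∈ R := mem_region_of_mem_cone_of_mem_region hT r F hF SD hSD₁ hSD₂ GC hGC R hRF hRS hRup (hGCmem w hw).1 (hGCmem w hw).2.1 hv'R hv'w
        refine ⟨w, Finset.mem_filter.2 ⟨(hsF w).2 hw, hwR⟩, Finset.mem_filter.2 ⟨(hsR v').2 hv'R, hv'w⟩⟩
    · rintro (rfl | ⟨w, hw, hv'w⟩)
      · rw [hsR, SimpleGraph.dist_self, add_zero]
        exact ⟨hvR, rfl⟩
      · rw [Finset.mem_filter] at hw hv'w
        exact ⟨hv'w.1, setOf_dist_subset_of_mem hT r (hGCmem w ((hsF w).1 hw.1)).2.2.2 hv'w.2⟩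
  have hnot : v ∉ (hfin.toFinset.filter (fun w => w ∈ R)).biUnion (fun w => sR.filter (fun v' => G.dist r v' = G.dist r w + G.dist w v')) := by
    rw [Finset.mem_biUnion]
    rintro ⟨w, hw, hvw⟩
    rw [Finset.mem_filter] at hw hvw
    have hd2 := (hGCmem w ((hsF w).1 hw.1)).2.2.1
    have h0 : G.dist r v = G.dist r w + G.dist w v := hvw.2
    omega
  have hdisj : ((hfin.toFinset.filter (fun w => w ∈ R)) : Set V).PairwiseDisjoint
      (fun w => sR.filter (fun v' => G.dist r v' = G.dist r w + G.dist w v')) := by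
    intro w hw w' hw' hne
    rw [Finset.coe_filter, Set.mem_setOf_eq] at hw hw'
    have hdw := (hGCmem w ((hsF w).1 hw.1)).2.2.1
    have hdw' := (hGCmem w' ((hsF w').1 hw'.1)).2.2.1
    have hD := disjoint_setOf_dist_of_ne hT r (c := w) (c' := w') (by rw [hdw, hdw']) hne
    rw [Function.onFun, Finset.disjoint_left]
    intro v' hv' hv''
    rw [Finset.mem_filter] at hv' hv''
    exact Set.disjoint_left.1 hD hv'.2 hv''.2
  rw [hoffsum, hregsum, hpart, Finset.sum_insert hnot, Finset.sum_biUnion hdisj]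
  abel

/-! ## §4 The ROOT-REGION assembly with `E ∕ P⁺ ∕ P⁻`-labelled off-region grandchildren (★ `hroot` shape, per region vertex) -/

/-- **THE ROOT-REGION ASSEMBLY, LABELLED FORM.**  If moreover the off-region fixed grandchildren of each region vertex `v` are of label `E_{k_v+1} = (2k_v+2, 2)` or
`P^±_{k_v} = (2k_v+1, 1, ±1)` with multiplicities `NE v`, `NP v`, `NM v` (the ★ `hroot` shape, now PER REGION VERTEX: ROOT ∕ MIDDLE ∕ END vertices of the axis carry
different multiplicities, ★ `DepthZeroKappaTransferTypeOneRamifiedAxisTwists` ∕ `…AxisEndTwists` + ★ `UnitaryLatticeTreeIsolatedRootChildClassRamified`), then the TOTAL strata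
vector of the fixed self-dual vertices is `Σ_{v ∈ R} (e₄ + NE v·T(E_{k_v+1}) + NP v·T(P⁺_{k_v}) + NM v·T(P⁻_{k_v}))`.  `R = {r}` is ★ `strataVec_total_eq_of_localLaw_of_root`.
[cite: Kottwitz1986, §3] [cite: Rogawski1990, §4.9 pp. 54–56] [cite: Serre1980Trees, I.2.3] -/
theorem strataVec_total_eq_of_localLaw_of_rootRegion_of_labels (hT : G.IsTree) (r : V) (F : Set V) (hFfin : F.Finite)
    (hF : ∀ w ∈ F, w ≠ r → ∀ u, G.Adj w u → G.dist r u + 1 = G.dist r w → u ∈ F) (SD : V → Prop) (str : Fin 5 → V → Prop)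
    [DecidablePred (· ∈ F)] [DecidablePred SD] [∀ j, DecidablePred (str j)]
    (hSD₁ : ∀ v c, G.Adj v c → SD v → ¬ SD c) (hSD₂ : ∀ c w, G.Adj c w → ¬ SD c → SD w)
    (dep rk : V → ℕ) (cl : V → ℤ)
    (hstr : ∀ w ∈ F, SD w → (str 0 w ↔ dep w = 0) ∧ (str 1 w ↔ dep w = 1 ∧ rk w = 2) ∧ (str 2 w ↔ dep w = 1 ∧ rk w = 1 ∧ cl w = 1) ∧
      (str 3 w ↔ dep w = 1 ∧ rk w = 1 ∧ cl w = -1) ∧ (str 4 w ↔ 2 ≤ dep w))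
    (GC : V → Set V)
    (hGC : ∀ v w, w ∈ GC v ↔ ∃ c, (G.Adj v c ∧ G.dist r c = G.dist r v + 1 ∧ c ∈ F) ∧ (G.Adj c w ∧ G.dist r w = G.dist r c + 1 ∧ w ∈ F))
    (q : ℕ) (s : ℤ) (R : Set V) (hrR : r ∈ R) (hRF : R ⊆ F) (hRS : ∀ v ∈ R, SD v) (hRdep : ∀ v ∈ R, 2 ≤ dep v)
    (hRup : ∀ v ∈ F, SD v → ∀ w ∈ GC v, w ∈ R → v ∈ R)
    (hrk : ∀ v ∈ F, SD v → v ∉ R → 1 ≤ dep v → rk v = 1 ∨ rk v = 2)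
    (hcl : ∀ v ∈ F, SD v → v ∉ R → rk v = 1 → cl v = 1 ∨ cl v = -1)
    (hodd : ∀ v ∈ F, SD v → v ∉ R → 2 ≤ dep v → rk v = 1 → Odd (dep v))
    (hB : ∀ v ∈ F, SD v → v ∉ R → dep v = 0 → GC v = ∅)
    (hC : ∀ v ∈ F, SD v → v ∉ R → dep v = 1 → rk v = 1 → GC v = ∅)
    (hR : ∀ v ∈ F, SD v → v ∉ R → dep v = 1 → rk v = 2 → (∀ w ∈ GC v, dep w = 0) ∧ (GC v).ncard = q)
    (hE : ∀ v ∈ F, SD v → v ∉ R → ∀ m, dep v = 2 * m + 2 → rk v = 2 → (∀ w ∈ GC v, dep w = 2 * m + 1 ∧ rk w = 2) ∧ (GC v).ncard = q ^ 2)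
    (hO : ∀ v ∈ F, SD v → v ∉ R → ∀ m, dep v = 2 * m + 3 → rk v = 2 →
      (∀ w ∈ GC v, (dep w = 2 * m + 2 ∧ rk w = 2) ∨ (dep w = 2 * m + 1 ∧ rk w = 1 ∧ (cl w = 1 ∨ cl w = -1))) ∧
        {w | w ∈ GC v ∧ dep w = 2 * m + 2}.ncard = q ∧ {w | w ∈ GC v ∧ dep w = 2 * m + 1 ∧ cl w = 1}.ncard = q.choose 2 ∧
          {w | w ∈ GC v ∧ dep w = 2 * m + 1 ∧ cl w = -1}.ncard = q.choose 2)
    (hP : ∀ v ∈ F, SD v → v ∉ R → ∀ m (c : ℤ), dep v = 2 * m + 3 → rk v = 1 → cl v = c →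
      (∀ w ∈ GC v, dep w = 2 * m + 1 ∧ rk w = 1 ∧ cl w = s * c) ∧ (GC v).ncard = q ^ 2)
    (TE TO : ℕ → Fin 5 → ℕ) (TP : ℤ → ℕ → Fin 5 → ℕ)
    (hTE : ∀ m, TE (m + 1) = ![0, 0, 0, 0, 1] + q ^ 2 • TO m)
    (hTO0 : TO 0 = ![0, 1, 0, 0, 0] + q • ![1, 0, 0, 0, 0])
    (hTOs : ∀ m, TO (m + 1) = ![0, 0, 0, 0, 1] + q • TE (m + 1) + q.choose 2 • (TP 1 m + TP (-1) m))
    (hTP0 : TP 1 0 = ![0, 0, 1, 0, 0]) (hTP0' : TP (-1) 0 = ![0, 0, 0, 1, 0])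
    (hTPs : ∀ m (c : ℤ), c = 1 ∨ c = -1 → TP c (m + 1) = ![0, 0, 0, 0, 1] + q ^ 2 • TP (s * c) m)
    (sR : Finset V) (hsR : ∀ v, v ∈ sR ↔ v ∈ R) (k NE NP NM : V → ℕ)
    (hlabR : ∀ v ∈ R, (∀ w ∈ GC v, w ∉ R → (dep w = 2 * k v + 2 ∧ rk w = 2) ∨ (dep w = 2 * k v + 1 ∧ rk w = 1 ∧ (cl w = 1 ∨ cl w = -1))) ∧
      {w | w ∈ GC v ∧ w ∉ R ∧ dep w = 2 * k v + 2}.ncard = NE v ∧ {w | w ∈ GC v ∧ w ∉ R ∧ dep w = 2 * k v + 1 ∧ cl w = 1}.ncard = NP v ∧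
        {w | w ∈ GC v ∧ w ∉ R ∧ dep w = 2 * k v + 1 ∧ cl w = -1}.ncard = NM v) :
    (fun j => (F ∩ {w | SD w ∧ str j w}).ncard) =
      ∑ v ∈ sR, ((![0, 0, 0, 0, 1] : Fin 5 → ℕ) + NE v • TE (k v + 1) + NP v • TP 1 (k v) + NM v • TP (-1) (k v)) := by
  classical
  -- the off-region grandchildren Finsets
  have hfin : ∀ v, (GC v ∩ Rᶜ).Finite := fun v => hFfin.subset (fun w hw => by
    obtain ⟨c, -, -, -, hwF⟩ := (hGC v w).1 hw.1
    exact hwF)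
  have hsOff : ∀ v ∈ R, ∀ w, w ∈ (hfin v).toFinset ↔ w ∈ GC v ∧ w ∉ R := fun v _ w => by
    rw [Set.Finite.mem_toFinset, Set.mem_inter_iff, Set.mem_compl_iff]
  rw [strataVec_total_eq_of_localLaw_of_rootRegion hT r F hFfin hF SD str hSD₁ hSD₂ dep rk cl hstr GC hGC q s R hrR hRF hRS hRdep hRup hrk hcl hodd hB hC hR hE hO hP
    TE TO TP hTE hTO0 hTOs hTP0 hTP0' hTPs sR hsR (fun v => (hfin v).toFinset) hsOff]
  refine Finset.sum_congr rfl (fun v hv => ?_)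
  have hvR : v ∈ R := (hsR v).1 hv
  obtain ⟨hlab, hcE, hcP, hcM⟩ := hlabR v hvR
  have hsF : ∀ w, w ∈ (hfin v).toFinset ↔ w ∈ GC v ∧ w ∉ R := hsOff v hvR
  -- split the off-region grandchildren by label, evaluate, count (★ §3b pattern)
  rw [← Finset.sum_filter_add_sum_filter_not (hfin v).toFinset (fun w => dep w = 2 * k v + 2),
    ← Finset.sum_filter_add_sum_filter_not ((hfin v).toFinset.filter (fun w => ¬ dep w = 2 * k v + 2)) (fun w => cl w = 1)]
  have hvE : ∀ w ∈ (hfin v).toFinset.filter (fun w => dep w = 2 * k v + 2),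
      (if dep w = 0 then ![1, 0, 0, 0, 0] else if rk w = 2 then (if Even (dep w) then TE (dep w / 2) else TO (dep w / 2)) else TP (cl w) (dep w / 2)
        : Fin 5 → ℕ) = TE (k v + 1) := by
    intro w hw
    rw [Finset.mem_filter] at hw
    obtain ⟨hwG, hwR⟩ := (hsF w).1 hw.1
    have hrw : rk w = 2 := by
      rcases hlab w hwG hwR with ⟨-, h⟩ | ⟨h, -⟩
      · exact h
      · omega
    rw [if_neg (by omega), if_pos hrw, if_pos (by rw [hw.2]; exact ⟨k v + 1, by ring⟩), hw.2, show (2 * k v + 2) / 2 = k v + 1 by omega]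
  have hvP : ∀ w ∈ ((hfin v).toFinset.filter (fun w => ¬ dep w = 2 * k v + 2)).filter (fun w => cl w = 1),
      (if dep w = 0 then ![1, 0, 0, 0, 0] else if rk w = 2 then (if Even (dep w) then TE (dep w / 2) else TO (dep w / 2)) else TP (cl w) (dep w / 2)
        : Fin 5 → ℕ) = TP 1 (k v) := by
    intro w hw
    rw [Finset.mem_filter, Finset.mem_filter] at hw
    obtain ⟨hwG, hwR⟩ := (hsF w).1 hw.1.1
    obtain ⟨hdw, hrw, -⟩ : dep w = 2 * k v + 1 ∧ rk w = 1 ∧ (cl w = 1 ∨ cl w = -1) := by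
      rcases hlab w hwG hwR with ⟨h, -⟩ | h
      · exact absurd h hw.1.2
      · exact h
    rw [if_neg (by omega), if_neg (by omega), hw.2, hdw, show (2 * k v + 1) / 2 = k v by omega]
  have hvM : ∀ w ∈ ((hfin v).toFinset.filter (fun w => ¬ dep w = 2 * k v + 2)).filter (fun w => ¬ cl w = 1),
      (if dep w = 0 then ![1, 0, 0, 0, 0] else if rk w = 2 then (if Even (dep w) then TE (dep w / 2) else TO (dep w / 2)) else TP (cl w) (dep w / 2)
        : Fin 5 → ℕ) = TP (-1) (k v) := by
    intro w hw
    rw [Finset.mem_filter, Finset.mem_filter] at hw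
    obtain ⟨hwG, hwR⟩ := (hsF w).1 hw.1.1
    obtain ⟨hdw, hrw, hcw⟩ : dep w = 2 * k v + 1 ∧ rk w = 1 ∧ (cl w = 1 ∨ cl w = -1) := by
      rcases hlab w hwG hwR with ⟨h, -⟩ | h
      · exact absurd h hw.1.2
      · exact h
    have hc : cl w = -1 := hcw.resolve_left hw.2
    rw [if_neg (by omega), if_neg (by omega), hc, hdw, show (2 * k v + 1) / 2 = k v by omega]
  have hcE' : ((hfin v).toFinset.filter (fun w => dep w = 2 * k v + 2)).card = NE v := by
    have hset : {w | w ∈ GC v ∧ w ∉ R ∧ dep w = 2 * k v + 2} = ↑((hfin v).toFinset.filter (fun w => dep w = 2 * k v + 2)) := by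
      ext w
      simp only [Set.mem_setOf_eq, Finset.coe_filter, Set.Finite.mem_toFinset, Set.mem_inter_iff, Set.mem_compl_iff, and_assoc]
    rw [← hcE, hset, Set.ncard_coe_finset]
  have hcP' : (((hfin v).toFinset.filter (fun w => ¬ dep w = 2 * k v + 2)).filter (fun w => cl w = 1)).card = NP v := by
    have hset : {w | w ∈ GC v ∧ w ∉ R ∧ dep w = 2 * k v + 1 ∧ cl w = 1} =
        ↑(((hfin v).toFinset.filter (fun w => ¬ dep w = 2 * k v + 2)).filter (fun w => cl w = 1)) := by
      ext w
      simp only [Set.mem_setOf_eq, Finset.coe_filter, Finset.mem_filter, Set.Finite.mem_toFinset, Set.mem_inter_iff, Set.mem_compl_iff]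
      constructor
      · rintro ⟨hw, hwR, hd, hc⟩
        exact ⟨⟨⟨hw, hwR⟩, by omega⟩, hc⟩
      · rintro ⟨⟨⟨hw, hwR⟩, hne⟩, hc⟩
        rcases hlab w hw hwR with ⟨h, -⟩ | ⟨h, -, -⟩
        · exact absurd h hne
        · exact ⟨hw, hwR, h, hc⟩
    rw [← hcP, hset, Set.ncard_coe_finset]
  have hcM' : (((hfin v).toFinset.filter (fun w => ¬ dep w = 2 * k v + 2)).filter (fun w => ¬ cl w = 1)).card = NM v := by
    have hset : {w | w ∈ GC v ∧ w ∉ R ∧ dep w = 2 * k v + 1 ∧ cl w = -1} =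
        ↑(((hfin v).toFinset.filter (fun w => ¬ dep w = 2 * k v + 2)).filter (fun w => ¬ cl w = 1)) := by
      ext w
      simp only [Set.mem_setOf_eq, Finset.coe_filter, Finset.mem_filter, Set.Finite.mem_toFinset, Set.mem_inter_iff, Set.mem_compl_iff]
      constructor
      · rintro ⟨hw, hwR, hd, hc⟩
        exact ⟨⟨⟨hw, hwR⟩, by omega⟩, by rw [hc]; norm_num⟩
      · rintro ⟨⟨⟨hw, hwR⟩, hne⟩, hc⟩
        rcases hlab w hw hwR with ⟨h, -⟩ | ⟨h, -, hcw⟩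
        · exact absurd h hne
        · exact ⟨hw, hwR, h, hcw.resolve_left hc⟩
    rw [← hcM, hset, Set.ncard_coe_finset]
  rw [Finset.sum_congr rfl hvE, Finset.sum_congr rfl hvP, Finset.sum_congr rfl hvM, Finset.sum_const, Finset.sum_const, Finset.sum_const,
    hcE', hcP', hcM']
  abel

/-! ## §5 The top level as a root region -/

/-- **The top level is a root region.**  If the depth label does not increase from a fixed self-dual vertex to its fixed grandchildren (`hmono`) and is bounded by `d₀`
on the fixed self-dual vertices (`hmax`), then `R = {v ∈ F | SD v ∧ dep v = d₀}` satisfies the closure hypothesis `hRup` of the root-region assembly (in the lattice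
model: the level of a fixed vertex is at most the level `d₀` of the root and does not increase down the fixed tree). [cite: Kottwitz1986, §3] [cite: Serre1980Trees, I.2.3] -/
theorem region_upClosed_of_dep_le (F : Set V) (SD : V → Prop) (dep : V → ℕ) (GC : V → Set V) (d₀ : ℕ)
    (hmono : ∀ v ∈ F, SD v → ∀ w ∈ GC v, dep w ≤ dep v) (hmax : ∀ v ∈ F, SD v → dep v ≤ d₀) :
    ∀ v ∈ F, SD v → ∀ w ∈ GC v, w ∈ {u | u ∈ F ∧ SD u ∧ dep u = d₀} → v ∈ {u | u ∈ F ∧ SD u ∧ dep u = d₀} := by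
  intro v hv hvS w hw hwR
  obtain ⟨-, -, hdw⟩ := hwR
  have h1 := hmono v hv hvS w hw
  have h2 := hmax v hv hvS
  exact ⟨hv, hvS, by omega⟩

end Literature.NumberTheory.Rogawski1990
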